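import Summits.HodgeConjecture.HodgeConjecture.Theorems.MarkmanPartnerTransportPicardThreeK3SquaresRealMultiplicationTypeExact

/-!
# Route MarkmanPartnerTransport · crux `PicardThreeK3Squares` (stmt-HodgeConjecture-19652) —
# «RM-TYPE-UNIQUE»: the degree `d = [E:ℚ]` of the real-multiplication type of a K3 surface is an INVARIANT

Sequel to `…RealMultiplicationType{,Corollaries,Exact}` («RM-GEN-K3», «RM-EXACT-K3»): there every non-CM, non-scalar projective K3
surface was shown to be an RM K3 surface `IsRealMultiplicationK3 S ρ(S) P` of SOME type `(ρ, deg P, m)`. Here: the degree is the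
same for every presentation — so «`S` has real multiplication by a field of degree `d`», `Terminal[S]`, `Quadratic[S]` are
intrinsic properties of `S`. Marking-light (only the spanning `(2,0)`-class of a marking is used):

* `natDegree_le_of_annihilated_of_generatedBy` — if `t` GENERATES the transcendental Hodge endomorphisms of `S` and is annihilated on
  `T(S)` by an irreducible `P`, then every admissible `t'` annihilated on `T(S)` by an irreducible `P'` has `deg P' ≤ deg P`: on the
  `(2,0)`-class `σ` (transcendental, `≠ 0`) the eigenvalues satisfy `P(ev) = 0`, `P'(ev') = 0` (`Module.End.aeval_apply_of_hasEigenvector`)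
  and `ev' = Q(ev)` for the rational polynomial `Q` with `t' = Q(t)` on `T(S)` (generation); so `ev' ∈ ℚ(ev)` and
  `deg P' = deg minpoly(ev') ≤ [ℚ(ev):ℚ] = deg minpoly(ev) = deg P`;
* **`natDegree_eq_of_isRealMultiplicationK3`** — two presentations `IsRealMultiplicationK3 S ρ P`, `IsRealMultiplicationK3 S ρ' P'` with
  `P`, `P'` irreducible have `deg P = deg P'` (and `ρ = ρ'`): the TYPE `(ρ, d, m)` of «RM-GEN-K3» is well defined.

No definition, no sorry, no named fact beyond the displayed `Huybrechts_K3_marking_exists`; nothing here proves the crux or HC.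
Prover seat hodge-nonav-19652-p1 (gen 19), `--supports stmt-HodgeConjecture-19652`.

References: Yu. G. Zarhin, J. reine angew. Math. 341 (1983) Thm. 1.5.1, 1.6; B. van Geemen, M. Schütt, Forum Math. Sigma 13 (2025) e2
§2.1; D. Huybrechts, *Lectures on K3 Surfaces*, Ch. 3 Cor. 3.3.6.
-/

set_option linter.dupNamespace false

noncomputable section

namespace Summit.HodgeConjecture.HodgeConjecture.Theorems.MarkmanPartnerTransport.RealMultiplicationType

open Module CategoryTheory MonoidalCategory CartesianMonoidalCategory Polynomial IntermediateField
open Literature.AlgebraicGeometry Literature.AlgebraicGeometry.Motives Literature.AlgebraicGeometry.HodgeTheory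
open Literature.AlgebraicGeometry.Surfaces
open Literature.AlgebraicTopology.SingularHomology
open Summit.HodgeConjecture.HodgeConjecture.Theorems
open Summit.HodgeConjecture.HodgeConjecture.Theorems.NikulinTwinTransport

variable {S : SchemeOver ℂ}

/-- `Transc[S, y]`: `y` is cup-orthogonal to `N¹(S)`. Local notation only. -/
local notation3 (prettyPrint := false) "Transc[" S ", " y "]" =>
  (∀ d ∈ algebraicClasses S 1, cupProduct (rfl : 2 * 1 + 2 * 1 = 2 * 2) y d = 0)

/-- Powers of an endomorphism act on an eigenvector by powers of the eigenvalue. [folklore] -/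
theorem pow_apply_eq_pow_smul (f : complexBetti S (2 * 1) →ₗ[ℂ] complexBetti S (2 * 1)) {σ : complexBetti S (2 * 1)}
    {ev : ℂ} (h : f σ = ev • σ) (k : ℕ) : (f ^ k) σ = ev ^ k • σ := by
  induction k with
  | zero => rw [pow_zero, pow_zero, Module.End.one_apply, one_smul]
  | succ k ih => rw [pow_succ', Module.End.mul_apply, ih, map_smul, h, smul_smul, ← pow_succ]

/-- The `(2,0)`-eigenvalue of an endomorphism annihilated on `T(S)` by `P` is a root of `P`
(`Module.End.aeval_apply_of_hasEigenvector` on a non-zero transcendental `(2,0)`-class). [cite: Zarhin1983HodgeGroupsK3, Thm. 1.6] -/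
theorem aeval_eigenvalue_eq_zero_of_annihilated (t : complexBetti S (2 * 1) →ₗ[ℂ] complexBetti S (2 * 1)) {P : ℚ[X]}
    (hann : IsAnnihilatedOnTranscendentalBy S t P) {σ : complexBetti S (2 * 1)} (hσT : Transc[S, σ]) (hσne : σ ≠ 0)
    {ev : ℂ} (hev : t σ = ev • σ) : Polynomial.aeval ev P = 0 := by
  have hE : Module.End.HasEigenvector t ev σ := ⟨Module.End.mem_eigenspace_iff.2 hev, hσne⟩
  have h := hann σ hσT
  rw [Module.End.aeval_apply_of_hasEigenvector hE, Polynomial.eval_map, ← Polynomial.aeval_def] at h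
  exact (smul_eq_zero.1 h).resolve_right hσne

/-- For an irreducible `P` with `P(ev) = 0`: `deg minpoly_ℚ(ev) = deg P`. [folklore] -/
theorem natDegree_minpoly_eq_of_irreducible {ev : ℂ} {P : ℚ[X]} (hP : Irreducible P) (hPev : Polynomial.aeval ev P = 0) :
    (minpoly ℚ ev).natDegree = P.natDegree := by
  rw [← minpoly.eq_of_irreducible hP hPev,
    Polynomial.natDegree_mul_C (inv_ne_zero (Polynomial.leadingCoeff_ne_zero.2 hP.ne_zero))]

/-- **The degree of a generating presentation bounds every other presentation.** For a projective K3 surface `S` (granted markings),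
`t` type-preserving, annihilated on `T(S)` by an irreducible `P` and GENERATING (`TranscendentalEndomorphismsGeneratedBy S t`), and `t'`
rational, type-preserving, killing `N¹(S)`, with image cup-orthogonal to `N¹(S)`, annihilated on `T(S)` by an irreducible `P'`:
`deg P' ≤ deg P`. Proof: `ev' = Q(ev)` for the rational `Q` with `t' = Q(t)` on `T(S)`, so `ℚ(ev') ⊆ ℚ(ev)`, and
`deg P' = deg minpoly(ev') ≤ [ℚ(ev):ℚ] = deg P`. [cite: Zarhin1983HodgeGroupsK3, Thm. 1.5.1 and Thm. 1.6] [cite: GeemenSchutt2023, §2.1] -/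
theorem natDegree_le_of_annihilated_of_generatedBy (hmark : Huybrechts_K3_marking_exists) (hS : IsK3Surface S)
    {t : complexBetti S (2 * 1) →ₗ[ℂ] complexBetti S (2 * 1)}
    (ht_typ : ∀ (i j : ℕ) y, IsOfHodgeType 2 S (2 * 1) i j y → IsOfHodgeType 2 S (2 * 1) i j (t y))
    {P : ℚ[X]} (hP : Irreducible P) (hann : IsAnnihilatedOnTranscendentalBy S t P)
    (hgen : TranscendentalEndomorphismsGeneratedBy S t)
    {t' : complexBetti S (2 * 1) →ₗ[ℂ] complexBetti S (2 * 1)}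
    (ht'_rat : ∀ y, IsRationalClass y → IsRationalClass (t' y))
    (ht'_typ : ∀ (i j : ℕ) y, IsOfHodgeType 2 S (2 * 1) i j y → IsOfHodgeType 2 S (2 * 1) i j (t' y))
    (ht'_N : ∀ d ∈ algebraicClasses S 1, t' d = 0) (ht'_perp : ∀ y : complexBetti S (2 * 1), Transc[S, t' y])
    {P' : ℚ[X]} (hP' : Irreducible P') (hann' : IsAnnihilatedOnTranscendentalBy S t' P') :
    P'.natDegree ≤ P.natDegree := by
  classical
  -- the spanning `(2,0)`-class of a marking: non-zero, transcendental
  have hHT : Huybrechts_K3_hodgeTypes_H2 := Huybrechts_K3_hodgeTypes_H2_holds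
  obtain ⟨η, p₀, x, -, ⟨-, -, -, hηcup, hx20, hx20'⟩, -, hxpos, -⟩ := hmark S hS
  set σ := η.symm x with hσdef
  have hησ : η σ = x := by rw [hσdef, LinearEquiv.apply_symm_apply]
  have hσne : σ ≠ 0 := by
    intro h0
    have hx : x = 0 := by rw [← hησ, h0, map_zero]
    subst hx; simp [k3Form] at hxpos
  obtain ⟨-, -, h₃⟩ := hHT S hS σ hx20 hσne
  have hσT : Transc[S, σ] := fun d hd => by
    have h11 := (h₃ d).1 (isOfHodgeType_of_mem_algebraicClasses_of_isSmoothProjective hS.1 1 hd)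
    rw [hηcup, k3Form_comm, ← hηcup]
    exact h11.1
  -- eigenvalues on `σ`
  obtain ⟨ev, hev⟩ : ∃ ev : ℂ, t σ = ev • σ := hx20' _ (ht_typ 2 0 σ hx20)
  obtain ⟨ev', hev'⟩ : ∃ ev' : ℂ, t' σ = ev' • σ := hx20' _ (ht'_typ 2 0 σ hx20)
  have hPev : Polynomial.aeval ev P = 0 := aeval_eigenvalue_eq_zero_of_annihilated t hann hσT hσne hev
  have hP'ev' : Polynomial.aeval ev' P' = 0 := aeval_eigenvalue_eq_zero_of_annihilated t' hann' hσT hσne hev'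
  -- `ev' = Σ aᵢ evⁱ` (generation)
  obtain ⟨n, a, ha⟩ := hgen t' ht'_rat ht'_typ ht'_N ht'_perp
  have hev'eq : ev' = ∑ i : Fin n, ((a i : ℚ) : ℂ) * ev ^ (i : ℕ) := by
    have h := ha σ hσT
    rw [hev'] at h
    simp_rw [pow_apply_eq_pow_smul t hev, smul_smul] at h
    rw [← Finset.sum_smul] at h
    have h2 : (ev' - ∑ i : Fin n, ((a i : ℚ) : ℂ) * ev ^ (i : ℕ)) • σ = 0 := by rw [sub_smul, h, sub_self]
    exact sub_eq_zero.1 ((smul_eq_zero.1 h2).resolve_right hσne)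
  -- field theory in `ℚ(ev) ⊂ ℂ`
  have hint : IsIntegral ℚ ev := by
    rw [← isAlgebraic_iff_isIntegral]
    exact ⟨P, hP.ne_zero, hPev⟩
  haveI : FiniteDimensional ℚ ℚ⟮ev⟯ := IntermediateField.adjoin.finiteDimensional hint
  have hmem : ev' ∈ ℚ⟮ev⟯ := by
    rw [hev'eq]
    refine sum_mem fun i _ => mul_mem ?_ (pow_mem (mem_adjoin_simple_self ℚ ev) _)
    have h := (ℚ⟮ev⟯).algebraMap_mem (a i)
    rwa [eq_ratCast] at h
  have h1 : (minpoly ℚ ev').natDegree ≤ Module.finrank ℚ ℚ⟮ev⟯ := by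
    have h := minpoly.natDegree_le (A := ℚ) (⟨ev', hmem⟩ : ℚ⟮ev⟯)
    have hmin : minpoly ℚ ev' = minpoly ℚ (⟨ev', hmem⟩ : ℚ⟮ev⟯) :=
      minpoly.algHom_eq (ℚ⟮ev⟯).val (ℚ⟮ev⟯).val.toRingHom.injective (⟨ev', hmem⟩ : ℚ⟮ev⟯)
    exact (congrArg Polynomial.natDegree hmin).trans_le h
  rw [IntermediateField.adjoin.finrank hint, natDegree_minpoly_eq_of_irreducible hP hPev,
    natDegree_minpoly_eq_of_irreducible hP' hP'ev'] at h1
  exact h1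

/-- **«RM-TYPE-UNIQUE»: the type of an RM K3 surface is well defined.** Two presentations `IsRealMultiplicationK3 S ρ P`,
`IsRealMultiplicationK3 S ρ' P'` of the same projective K3 surface with `P`, `P'` irreducible have `deg P = deg P'` (and `ρ = ρ'`):
the field degree `[E:ℚ]` of «RM-GEN-K3» is an invariant of `S`. [cite: GeemenSchutt2023, §2.1] [cite: Zarhin1983HodgeGroupsK3, Thm. 1.5.1] -/
theorem natDegree_eq_of_isRealMultiplicationK3 (hmark : Huybrechts_K3_marking_exists) {ρ ρ' : ℕ} {P P' : ℚ[X]}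
    (h : IsRealMultiplicationK3 S ρ P) (h' : IsRealMultiplicationK3 S ρ' P') (hP : Irreducible P) (hP' : Irreducible P') :
    P.natDegree = P'.natDegree ∧ ρ = ρ' := by
  obtain ⟨hS, hρ, -, t, ht_rat, ht_typ, ht_N, ht_perp, hann, hgen⟩ := h
  obtain ⟨-, hρ', -, t', ht'_rat, ht'_typ, ht'_N, ht'_perp, hann', hgen'⟩ := h'
  exact ⟨le_antisymm
      (natDegree_le_of_annihilated_of_generatedBy hmark hS ht'_typ hP' hann' hgen' ht_rat ht_typ ht_N ht_perp hP hann)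
      (natDegree_le_of_annihilated_of_generatedBy hmark hS ht_typ hP hann hgen ht'_rat ht'_typ ht'_N ht'_perp hP' hann'),
    hρ.symm.trans hρ'⟩

/-- **The type `(ρ, d, m)` is unique**: with `deg P · m + ρ = 22 = deg P' · m' + ρ'` for two irreducible presentations, `m = m'` too.
[cite: GeemenSchutt2023, §2.1 and §2.4] -/
theorem type_eq_of_isRealMultiplicationK3 (hmark : Huybrechts_K3_marking_exists) {ρ ρ' m m' : ℕ} {P P' : ℚ[X]}
    (h : IsRealMultiplicationK3 S ρ P) (h' : IsRealMultiplicationK3 S ρ' P') (hP : Irreducible P) (hP' : Irreducible P')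
    (hm : P.natDegree * m + ρ = 22) (hm' : P'.natDegree * m' + ρ' = 22) :
    P.natDegree = P'.natDegree ∧ ρ = ρ' ∧ m = m' := by
  obtain ⟨hd, hρ⟩ := natDegree_eq_of_isRealMultiplicationK3 hmark h h' hP hP'
  refine ⟨hd, hρ, ?_⟩
  have hpos : 0 < P.natDegree := hP.natDegree_pos
  rw [← hd, ← hρ] at hm'
  have : P.natDegree * m = P.natDegree * m' := by omega
  exact Nat.eq_of_mul_eq_mul_left hpos this

end Summit.HodgeConjecture.HodgeConjecture.Theorems.MarkmanPartnerTransport.RealMultiplicationType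

end
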